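import Summits.QuantumFields.BalabanUV.T4Continuum.Support.NE7HintOfLocalChartSU2WideDecSlice
import Summits.QuantumFields.BalabanUV.T4Continuum.Support.NE7HintOfCubeChartSU2
import Summits.QuantumFields.BalabanUV.T4Continuum.Support.NE7CubeChartTorus
import HarnessLib

/-!
# GEN 99 RE-THREAD (`…Slice`, Bałaban-slice road, memo `t4/b2b-balaban-t4-ne7-p1-g99/ROAD-G99.md` §3.5 ∕ §3.8): this file is `NE7HintOfCubeChartSU2Dec`'s CHAIN THEOREM VERBATIM except that
# the slice `T_♮(U♯) = frameFreeBlockLandauW` of the per-pair binder is replaced by an ABSTRACT SLICE FAMILY `𝒯 k U♯` with the two hypotheses (hT) «tangent-critical ⟹ critical on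
# `𝒯 j W`» and (hP) «class SlicePoincare for `𝒯 j W`» in the generic theorems, and by the corner-free energy block-Landau slice `𝒯_E = energyBlockLandauW` (both hypotheses
# DISCHARGED: `hT_energyBlockLandau`, `classSlicePoincare_energyBlockLandau_SU2`, constant `8·CPLine 4 2 2 10⁻¹⁷ 10⁻⁵³ + 1`) in the SU(2) `d = 4` `L = 2` theorems; chain predecessors are
# the `…Slice` ∕ `…GenericSlice` re-issues (lineage `b2b-balaban-t4-ne7-p1` gen 99, CRUX PROVER NE7 #1).  NOT NE7; spine 0∕9.  Original docstring follows.

# GEN 95 RE-THREAD (`…Dec`): this file is `NE7HintOfCubeChartSU2`'s CHAIN THEOREM VERBATIM except that F31's per-pair binder `hleaves` (row NE3's weight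
# currency, numerically refuted for arbitrary pairs — memo `t4/b2b-balaban-t4-ne7-p1-g95/WEIGHT-CURRENCY-DEAD.md`) is replaced by F327's honest binder `hdecomp`
# (decomposition `X = X_T + X_N` with its two energy letters and k-free currencies `(α̂, ν̂, κ̂)`) and route Π's uniform block by ONE k-free line; the chart
# content is untouched (auxiliary theorems are imported from the original file BY NAME) and chain predecessors are the `…Dec` re-issues.  Original docstring follows.

# NE7 — (8)∃ FROM THE PRINTED FIRST-ORDER CHART OF [B11] Thm 1 (9) ON CUBES, SU(2)∕U(2) on T⁴, `L = 2` (F298): around every point `z` a unitary gauge `u₀`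
# and a potential `A₀` with `U^{u₀} = e^{A₀}`, `A₀` skew, `‖A₀‖ ≤ c₀t∕M`, `‖∇A₀‖ ≤ c₁t∕M²` on the sup-cube of radius `(nbRad + 2ℓ + 11)·M` (`t = r + 4(e^β − 1) + ε`,
# `c₀, c₁ ≤ A(ℓ+1)^p`) ⟹ `hchart` of F286w (F297) ⟹ (8)∃

Cell `pub-balaban`, rung (B)+1 sub-cell t4, lineage `b2b-balaban-t4-ne7-p1` (CRUX PROVER NE7 #1 = OWNER of row NE7), generation 92; memo
`t4/b2b-balaban-t4-ne7-p1-g92/LOG-OBSTRUCTION.md`.  Over F286w `NE7HintOfLocalChartSU2Wide.hint_of_localChart_SU2_wide` ((8)∃ ⇐ hchart ∧ hleaves ∧ lines on the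
wide cover) and F297 `NE7CubeChartTorus.exists_periodic_chart_of_cubeChart` (cube chart ⟹ periodic chart).

WHY.  THE END OF RECORD OF ROW NE7 REVERTS TO THE FIRST-ORDER CHART.  Gen 91 reduced F286w's chart binder to the covariant plaquette-gradient radius `x₁ ≤ C_g·t∕M³`
((PG), F291) and to local second-difference letters `‖∇∇A‖ ≤ c₂t∕M³` ((REG9), F295), both with `k`-UNIFORM constants.  Those are NOT what [Balaban1985Variational]
Thm 1 prints — (9) bounds `‖A‖_{1,β}` for `β ≤ β₀` with `B₄(β₀)` depending on `β₀`, (10) only `|∂*∂A|`, `|ΔA|`; [Balaban1985RegularSpaces] p. 83: «Such information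
is unavailable for the second order derivatives» — and they FAIL by a factor `log M = (k+1) log 2` for generic data: the constraint current `j = Q*λ` of the
minimiser is block-column-wise constant with jumps across block faces, and at a codimension-2 block edge the mixed second difference of the lattice potential
`Δ⁻¹j` is `(mixed jump)·(log M)∕(2π) + O(1)` (memo §1–§2; lattice computation job j326303: the corner value steps by `0.1104 = log 2∕(2π)` per doubling, n = 31 … 2047).
The FIRST-ORDER letters `|A| ≲ M_c·t∕M`, `|∇A| ≲ M_c·t∕M²` on a cube of `M_c` blocks ARE (9)'s first two clauses verbatim (one derivative of the potential of a
bounded source carries no logarithm), and they are all F286w consumes.  This file therefore states the NE7-specific input of route 1's END in exactly that printed,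
LOCAL, first-order form — a cube chart about every point — and discharges the torus plumbing (periodic gauge, periodic field, global letters) by F297.
WHAT ([folklore] composition + arithmetic; 0 def, 0 sorry).  §1 `chart_of_cubeChart_SU2`: (CUBE) with letters `c₀, c₁` on the `Kc`-fold cover, `Kc ≥ 4ℓ + 64` ⟹
`hchart` of F286w with `C₀ = c₀`, `C₁ = c₀ + c₁` (cube radius `R′ = (nbRad+2ℓ+11)M`, collar `M`, ball `(nbRad+2ℓ+10)M`; `2R′ + 4 ≤ N·Kc·M`).  §2 **`hint_of_cubeChart_SU2`**:
∀ `A ≥ 0`, `p` ∃ `ℓ ≥ 1`, `ε₀ > 0` ∀ `0 < ε ≤ ε₀` ∃ `β₀ > 0` ∀ `0 < β ≤ β₀` ∀ `N ≥ 1` ∀ `c₀, c₁ ∈ [0, A(ℓ+1)^p]`: route Π's two lines ∧ (CUBE on the `(4ℓ+64)`-fold cover)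
∧ hleaves ⟹ (8)∃.
HONEST FRAMING (page 1): (CUBE) is [B11] Thm 1 (9) TYPE (first-order letters, local), asserted for nothing; hleaves ([B11] Prop 2 TYPE) likewise; nothing of Bałaban's
asserted as an axiom; NE7 NOT PROVED unconditionally; spine 0∕9; finite T⁴ rung (B)+1 — NOT infinite volume, NOT mass gap, NOT `BetaPertH`, NOT Clay.  Continuum YM
on T⁴ ⇐ BetaPertH ∧ nine spine estimates (0/9 proved); BetaPertH ⇐ (D1) ∧ (D4) ∧ CAP+tail; G-an2-4 gates asym, D1 and NE2/3/4.  No `sorry`; axioms ⊆ {propext,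
Classical.choice, Quot.sound}.
-/

set_option autoImplicit false

open scoped BigOperators Matrix Matrix.Norms.L2Operator Topology
open NormedSpace Finset Set Filter

namespace Summit.QuantumFields.BalabanUV.T4Continuum.NE7HintOfCubeChartSU2DecSlice

open Literature.MathematicalPhysics.QuantumFieldTheory.Balaban1983to89
open B7Prop1Explicit B7Prop2Explicit MatrixLog UnitaryModel
open B4TorusKernel.MultiPeriod (torusSupNorm)
open T4AveragingDeficitWall (Ad IsUnitaryCfg IsSkewDir SmallField vary curl curlSq dirSq dirL1)
open T4AveragingDeficitWallBoundary (IsPeriodicCfg periodBox)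
open AveragingDeficitPeriodicCounting (IsPeriodicDir)
open AveragingDeficitMultiLevelPrep (LevelSmall tower TangentIter)
open BlockAverageVaryHolo (nbRad)
open MinimalActionLevels (perWin)
open MinimalActionSandwich (IsMinimiser admissible)
open MinimalActionRate (sfClass)
open NE3HessForm (dAction)
open NE3SlicePoincareBudgetLine (CPLine)
open NE3TangentCovariantTower (dirIter)
open NE3DecomposedRepOfLinearNormalPart (ResidualSliceRepT)
open NE3QbarIterCovLiftPrep (cruxC)
open NE3SmoothRightInverseW (rightInvW)
open NE3RightInverseSolveLetters (thetaLoc)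
open NE3RightInverseL2Letter (l2C)
open NE3HatInvCurlLetters (curl2C curl1C)
open NE3EnergyShapes (IsUnitarySite)
open BlockAveragePushDirSplit (flat)
open NE7HintOfLocalChartSU2WideDecSlice (hint_of_localChart_SU2_wide)
open NE7HintOfCubeChartSU2 (chart_of_cubeChart_SU2)
open NE3EnergyWeightedShapes (energyNormW)
open NE7MeanZeroGaugeSliceW (energyBlockLandauW)
open NE7EnergyBlockLandauClassPoincare (classSlicePoincare_energyBlockLandau_SU2)
open NE7ConvOneStepGenericSlice (hT_energyBlockLandau)
open T4AveragingDeficitWall (curl)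
open NE7CubeChartTorus (exists_periodic_chart_of_cubeChart)

noncomputable section

variable {n : Type*} [Fintype n] [DecidableEq n]

/-! ## §2 (8)∃ from the printed cube chart (§1, the `hchart` binder from a cube chart, is imported from the original file) -/

set_option maxHeartbeats 800000 in
/-- **F298 — (8)∃ FROM THE PRINTED FIRST-ORDER CHART OF [B11] Thm 1 (9) ON CUBES, SU(2)∕U(2) on T⁴, `L = 2`.**  [Balaban1985Variational] Thm 1 (8) ∘ Prop 8 ∘ (9)
first-order TYPE, rows NE7 ∘ NE3, `card n = 2`: for all `A ≥ 0` and `p` there are `ℓ ≥ 1`, `ε₀ > 0` and, for every `0 < ε ≤ ε₀`, a `β₀ > 0` such that for `0 < β ≤ β₀`,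
every period `N ≥ 1` and all `c₀, c₁ ∈ [0, A(ℓ+1)^p]`: IF route Π's two `k`-free lines (letters `C₂, αh, Ch, νh, κh`), the CUBE CHART (around every point `z` of
every tangent-critical admissible configuration on the `(4ℓ+64)`-fold cover with small field `r ≤ ε∕4`: a unitary gauge `u₀` and a skew `A₀` with `U^{u₀} = e^{A₀}`,
`‖A₀‖ ≤ c₀t∕M`, `‖∇A₀‖ ≤ c₁t∕M²` on the sup-cube of radius `(nbRad 4 2 + 2ℓ + 11)·M`), and row NE3's `hleaves` (at `δ₁ = ε∕8`) hold, THEN for some `δ_V > 0`, over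
`{V | unitary, N-periodic, SmallField V δ_V}`, at every level some constrained minimiser over `sfClass 4 2 N ε` is `SmallField U a` with `0 ≤ a < ε∕(2^k)²`.  The
torus plumbing of THE CHART is discharged (§1); NE7 is NOT proved unconditionally ((CUBE), `hleaves` and the two lines remain). -/
theorem hint_of_cubeChart_SU2 [Nonempty n] (hn : Fintype.card n = 2) {A : ℝ} (hA : 0 ≤ A) (p : ℕ) :
    ∃ ℓ : ℕ, 1 ≤ ℓ ∧ ∃ ε₀ : ℝ, 0 < ε₀ ∧ ∀ ε : ℝ, 0 < ε → ε ≤ ε₀ → ∃ β₀ : ℝ, 0 < β₀ ∧ ∀ β : ℝ, 0 < β → β ≤ β₀ →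
    ∀ (N : ℕ) [NeZero N] (αh νh κh c₀ c₁ : ℝ), 1 ≤ N →
    -- the k-free ceilings `(α̂, ν̂, κ̂)` of the honest per-pair binder and ONE k-free strict line (F327)
    2 * κh < ((((1 / 2 - νh ^ 2) / (2 * (1 + (8 * CPLine 4 2 2 (1 / 10 ^ 17) (1 / 10 ^ 53) + 1))) - νh ^ 2) / 2 - 576 * ((4 : ℕ) : ℝ) * (αh ^ 2 * Real.exp (2 * αh))) / (Fintype.card n : ℝ) - 28 * ((4 : ℕ) : ℝ) * (ε + 7 * αh ^ 2)) →
    0 ≤ c₀ → c₀ ≤ A * ((ℓ : ℝ) + 1) ^ p → 0 ≤ c₁ → c₁ ≤ A * ((ℓ : ℝ) + 1) ^ p →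
    -- (CUBE): the printed first-order chart of [B11] Thm 1 (9) about every point, on the `(4ℓ+64)`-fold cover
    (∀ D : Site 4 → Fin 4 → (Matrix n n ℂ)ˣ, IsUnitaryCfg D → IsPeriodicCfg D ((N * (4 * ℓ + 64)) : ℤ) → SmallField D (4 * (Real.exp β - 1)) →
      ∀ (k : ℕ), ∀ U ∈ admissible (sfClass 4 2 (N * (4 * ℓ + 64)) ε) 2 (k + 1) D,
      (∀ φ : Site 4 → Fin 4 → Matrix n n ℂ, IsSkewDir φ → IsPeriodicDir φ (((N * (4 * ℓ + 64)) * 2 ^ (k + 1) : ℕ) : ℤ) → TangentIter 2 k U φ →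
        dAction U φ (perWin 4 ((N * (4 * ℓ + 64)) * 2 ^ (k + 1))) = 0) →
      ∀ r : ℝ, 0 ≤ r → r ≤ (1 / ((2 : ℕ) : ℝ) ^ 2 * ε) → SmallField U (r / (((2 : ℕ) : ℝ) ^ (k + 1)) ^ 2) →
      ∀ z : Site 4, ∃ (u₀ : Site 4 → (Matrix n n ℂ)ˣ) (A₀ : Site 4 → Fin 4 → Matrix n n ℂ), IsUnitarySite u₀ ∧
        (∀ (p : Site 4) (μ : Fin 4), (∀ i, |p i - z i| ≤ (((nbRad 4 2 + 2 * ℓ + 11) * 2 ^ (k + 1) : ℕ) : ℤ)) → gaugeAct u₀ U p μ = expUnit (A₀ p μ)) ∧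
        (∀ (p : Site 4) (μ : Fin 4), (∀ i, |p i - z i| ≤ (((nbRad 4 2 + 2 * ℓ + 11) * 2 ^ (k + 1) : ℕ) : ℤ)) → A₀ p μ ∈ skewAdjoint (Matrix n n ℂ)) ∧
        (∀ (p : Site 4) (μ : Fin 4), (∀ i, |p i - z i| ≤ (((nbRad 4 2 + 2 * ℓ + 11) * 2 ^ (k + 1) : ℕ) : ℤ)) →
          ‖A₀ p μ‖ ≤ c₀ * (r + 4 * (Real.exp β - 1) + ε) / ((2 : ℕ) : ℝ) ^ (k + 1)) ∧
        (∀ (p : Site 4) (μ τ : Fin 4), (∀ i, |p i - z i| ≤ (((nbRad 4 2 + 2 * ℓ + 11) * 2 ^ (k + 1) : ℕ) : ℤ)) →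
          (∀ i, |(p + e τ) i - z i| ≤ (((nbRad 4 2 + 2 * ℓ + 11) * 2 ^ (k + 1) : ℕ) : ℤ)) →
          ‖A₀ (p + e τ) μ - A₀ p μ‖ ≤ c₁ * (r + 4 * (Real.exp β - 1) + ε) / (((2 : ℕ) : ℝ) ^ (k + 1)) ^ 2)) →
    -- THE HONEST PER-PAIR BINDER `hdecomp` on the data class (F327's)
    (∀ D : Site 4 → Fin 4 → (Matrix n n ℂ)ˣ, IsUnitaryCfg D → IsPeriodicCfg D (N : ℤ) → SmallField D (4 * (Real.exp β - 1)) → ∀ (k : ℕ), ∀ Us ∈ admissible (sfClass 4 2 N ε) 2 (k + 1) D, SmallField Us ((1 / ((2 : ℕ) : ℝ) ^ 2 * ε / 2) / (((2 : ℕ) : ℝ) ^ (k + 1)) ^ 2) → (∀ φ : Site 4 → Fin 4 → Matrix n n ℂ, IsSkewDir φ → IsPeriodicDir φ ((N * 2 ^ (k + 1) : ℕ) : ℤ) → TangentIter 2 k Us φ → dAction Us φ (perWin 4 (N * 2 ^ (k + 1))) = 0) → ∀ U' ∈ admissible (sfClass 4 2 N ε) 2 (k + 1) D, 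
      ∃ (u : Site 4 → (Matrix n n ℂ)ˣ) (X XT XN : Site 4 → Fin 4 → Matrix n n ℂ) (α ν κ : ℝ),
        IsUnitarySite u ∧ IsSkewDir X ∧ IsPeriodicDir X ((N * 2 ^ (k + 1) : ℕ) : ℤ) ∧ 0 ≤ α ∧ (∀ x μ, ‖X x μ‖ ≤ α) ∧
        gaugeAct u U' = vary Us X 1 ∧
        X = XT + XN ∧ XT ∈ energyBlockLandauW (d := 4) (n := n) 2 N (k + 1) Us ∧ IsSkewDir XN ∧ 0 ≤ ν ∧
        energyNormW 2 (k + 1) Us XN (periodBox (d := 4) (N * 2 ^ (k + 1)))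
          ≤ ν * energyNormW 2 (k + 1) Us X (periodBox (d := 4) (N * 2 ^ (k + 1))) ∧
        ε / (((2 : ℕ) : ℝ) ^ (k + 1)) ^ 2 * (∑ p ∈ perWin 4 (N * 2 ^ (k + 1)), ‖curl Us XN p‖)
          ≤ κ * energyNormW 2 (k + 1) Us X (periodBox (d := 4) (N * 2 ^ (k + 1))) ^ 2 ∧
        α * ((2 : ℕ) : ℝ) ^ (k + 1) ≤ αh ∧ ν ≤ νh ∧ κ ≤ κh) →
    ∃ δV : ℝ, 0 < δV ∧
      ∀ V ∈ {V : Site 4 → Fin 4 → (Matrix n n ℂ)ˣ | IsUnitaryCfg V ∧ IsPeriodicCfg V (N : ℤ) ∧ SmallField V δV},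
      ∀ k : ℕ, ∃ U : Site 4 → Fin 4 → (Matrix n n ℂ)ˣ, IsMinimiser 4 (sfClass 4 2 N ε) 2 N k V U ∧
        ∃ a : ℝ, 0 ≤ a ∧ a < ε / (((2 : ℕ) : ℝ) ^ k) ^ 2 ∧ SmallField U a := by
  obtain ⟨ℓ, hℓ1, ε₀, hε₀, H⟩ := hint_of_localChart_SU2_wide (n := n) hn (A := 2 * A) (by positivity) p
  refine ⟨ℓ, hℓ1, ε₀, hε₀, fun ε hε hεle => ?_⟩
  obtain ⟨β₀, hβ₀, H2⟩ := H ε hε hεle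
  refine ⟨β₀, hβ₀, ?_⟩
  intro β hβ hβle N _ αh νh κh c₀ c₁ hN hline hc₀ hc₀b hc₁ hc₁b hcube hdecomp
  have hpow : 0 ≤ A * ((ℓ : ℝ) + 1) ^ p := by positivity
  have hC₀b : c₀ ≤ 2 * A * ((ℓ : ℝ) + 1) ^ p := by linarith
  have hC₁ : 0 ≤ c₀ + c₁ := by positivity
  have hC₁b : c₀ + c₁ ≤ 2 * A * ((ℓ : ℝ) + 1) ^ p := by linarith
  have hchart := chart_of_cubeChart_SU2 (n := n) ℓ hN (Kc := 4 * ℓ + 64) le_rfl hε.le hβ.le hc₀ hc₁ hcube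
  exact H2 β hβ hβle N (4 * ℓ + 64) c₀ (c₀ + c₁) αh νh κh hN (by omega)
    hline hc₀ hC₀b hC₁ hC₁b hchart hdecomp

end

end Summit.QuantumFields.BalabanUV.T4Continuum.NE7HintOfCubeChartSU2DecSlice
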